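import Mathlib
import HarnessLib
import Literature.Analysis.FluidPDE.Tao2016AveragedNS.LocalCascadeSolutions
import Literature.Analysis.FluidPDE.Tao2016AveragedNS.RenormalisedCascadeWaves
import Literature.Analysis.FluidPDE.Tao2016AveragedNS.ViscousEternalSolutions
import Literature.Analysis.FluidPDE.Tao2016AveragedNS.BoundedEternalSolutions
import Summits.NavierStokesRegularity.NavierStokesRegularity.Theorems.TaoLadderRungTwoBreakEternalRigidityViscBddOneDefs
import Summits.NavierStokesRegularity.NavierStokesRegularity.Theorems.TaoLadderRungTwoBreakEternalRigidityViscBddOneFiringFloor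
import Summits.NavierStokesRegularity.NavierStokesRegularity.Theorems.TaoLadderRungTwoBreakEternalRigidityViscBddOneDissipationLedger
import Summits.NavierStokesRegularity.NavierStokesRegularity.Theorems.TaoLadderRungTwoBreakEternalRigidityViscBddOneRiseDissipation

/-!
# Crux `TaoLadderRungTwoBreak.EternalRigidityViscBddOne` (stmt-NavierStokesRegularity-20420): the REYNOLDS THRESHOLD of a viscous
# blow-up DIVERGES as `ε₀ → 0` at fixed spread — `ν⁴ ≤ 2³³ λ²⁴ (λ⁴ − 1) · (Σ_i X₀ᵢ²)²` for every blowing-up regular `ν`-trajectory,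
# every table of `InTableClass R`, every `R`, every `ε₀ > 0`

MODEL lattice ODEs only (Tao 2016 §4: the exact NS-scaled `ν`-viscous cascade lattice of a table of `InTableClass R`, `m = 4`, from a
one-shell datum, in the registered vocabulary `ViscousUpTo` / `BlowsUpAt` / `TypeOne` of the skeleton `85fbfe8e90eea58b`); nothing here
is a statement about the Navier–Stokes equations; no stub, crux or summit is closed (`--supports stmt-NavierStokesRegularity-20420`).
`λ = 1+ε₀`, `S = Σ_i X₀ᵢ²` (twice the datum energy), `c₀ = 1/(32768 λ^{16})` (the tree's firing constant).

The tree's datum floor (`…SmallDatumNoBlowup.datumFloor_of_blowsUpAt`: blow-up ⟹ `c₀ν² ≤ S`) is UNIFORM in `ε₀`.  Here the scale ratio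
enters: a blow-up must fire EVERY shell (`everyShellFires_explicit`: `λⁿ‖X_n(t_n)‖² ≥ c₀ν²`), each shell starts EMPTY and can rise only as
fast as its neighbours feed it, and while it sits between a quarter and the whole of its firing level it DISSIPATES
(`RiseDissipation.rise_dissipation`); summed over the `≍ 1/ε₀` shells of an octave this dissipation exceeds the datum energy unless the
datum is `ε₀^{-1/4}`-large in units of `ν`:

* `ledger_sum` — along a blowing-up regular `ν`-trajectory (clause form, shells below `0` empty): for every `M`,
  `2κ ν⁴ Σ_{m<M} λ^{−4(m+1)} ≤ S²`, `κ = 3c₀√c₀/4096` (fire the EVEN shells `n = 2(m+1)` at level `a² = c₀ν²λ^{−n}`, apply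
  `rise_dissipation` with `w = λ^{5(m+1)}`, and sum against the summed budget `Σ_k νλ^{2k}∫‖X_k‖² ≤ S/2`,
  `dissipation_budget_finset_sum_window`);
* `reynolds_threshold_of_blowsUpAt` — **in the skeleton's vocabulary**: `ViscousUpTo ε₀ ν α X₀ X t⋆ ∧ BlowsUpAt ε₀ X t⋆ ⟹
  ν⁴ ≤ 2³³ (1+ε₀)²⁴ ((1+ε₀)⁴ − 1) (Σ_i X₀ᵢ²)²` (geometric series; `2κ ≥ 2^{−33}λ^{−24}`); for `ε₀ ≤ 1`:
  `ν⁴ ≤ 2⁶¹ ε₀ (Σ_i X₀ᵢ²)²` (`reynolds_threshold_of_blowsUpAt_le_one`) — the blow-up threshold in `S/ν²` is `≥ 2^{−30.5} ε₀^{−1/2}`;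
* `not_blowsUpAt_of_small_reynolds` and `stubs_of_small_reynolds` — NO BLOW-UP, hence (ω3) `TypeOne` and (ω4) (bounded surviving eternal
  ω-limit) VACUOUSLY, on the class `2⁶¹ ε₀ (Σ_i X₀ᵢ²)² < ν⁴`; and the FIXED-REYNOLDS form `eventually_regular_of_fixed_datum`: for every datum
  `X₀` and `ν > 0` there is `ε₁ > 0` such that for ALL `ε₀ ≤ ε₁`, ALL `R` and ALL tables of `InTableClass R`, no regular `ν`-trajectory
  from `X₀` blows up — the quantifier order complementary to the stubs' (`εs` before `X₀, ν`).

READING for ⟨20420⟩ (repair census): along the registered line the open content is sub-threshold viscous regularity UNIFORMLY in the Reynolds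
number `S/ν²` (`…StubDuality`); this file proves it for `S/ν² ≤ 2^{−30.5}ε₀^{−1/2}`, a window that opens up as `ε₀ → 0` but never covers all
data at once.  What (ω3)/(ω4) still need is the complement: blow-ups with `S/ν² ≳ ε₀^{−1/2}` (type-I rate / extraction), or regularity there.
HONEST LABEL: (ω3), (ω4), ⟨20420⟩, the Target and every NS statement remain OPEN; rung 0.
-/

noncomputable section

-- the summit and its single sub-problem share the name (CONVENTIONS §1)
set_option linter.dupNamespace false

namespace Summit.NavierStokesRegularity.NavierStokesRegularity.Theorems.EternalRigidityViscBddOne.ReynoldsThreshold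

open Set Filter Topology MeasureTheory
open Literature.Analysis.FluidPDE Literature.Analysis.FluidPDE.TaoCascade
open Summit.NavierStokesRegularity.NavierStokesRegularity.Theorems.MinimalViscousBlowup.ThresholdRay
open Summit.NavierStokesRegularity.NavierStokesRegularity.Theorems.EternalRigidityViscBddOne.Birth
open Summit.NavierStokesRegularity.NavierStokesRegularity.Theorems.EternalRigidityViscBddOne.FiringFloor
open Summit.NavierStokesRegularity.NavierStokesRegularity.Theorems.EternalRigidityViscBddOne.DissipationLedger
open Summit.NavierStokesRegularity.NavierStokesRegularity.Theorems.EternalRigidityViscBddOne.RiseDissipation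

/-! ## Summing the ledger along a blow-up -/

/-- A window `(0,T']`, `T' < T`, containing finitely many given times `t m < T`. [folklore] -/
theorem exists_window {T : ℝ} (hT : 0 < T) (t : ℕ → ℝ) (ht : ∀ m, t m < T) (M : ℕ) :
    ∃ T' : ℝ, 0 < T' ∧ T' < T ∧ ∀ m, m < M → t m ≤ T' := by
  induction M with
  | zero => exact ⟨T / 2, by linarith, by linarith, fun m hm => absurd hm (Nat.not_lt_zero m)⟩
  | succ M ih =>
    obtain ⟨T', hT'0, hT'T, hle⟩ := ih
    refine ⟨max T' (t M), lt_max_of_lt_left hT'0, max_lt hT'T (ht M), fun m hm => ?_⟩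
    rcases Nat.lt_or_ge m M with h | h
    · exact (hle m h).trans (le_max_left _ _)
    · have hmM : m = M := by omega
      rw [hmM]; exact le_max_right _ _

/-- **THE SUMMED LEDGER.**  For a table of `InTableClass R` and a regular trajectory of the `ν`-viscous lattice on `[0,T)` from the one-shell
datum `X₀` (shells below `0` empty at all times) whose weight-10 norm is unbounded on `[0,T)`: for every `M`,
`2κ·ν⁴·Σ_{m<M} (λ⁴)^{−(m+1)} ≤ S²`, `S = Σ_i X₀ᵢ²`, `κ = 3c₀√c₀/4096`, `c₀ = 1/(32768λ^{16})` (the even shells `2(m+1)` fire at level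
`c₀ν²λ^{−2(m+1)}`, each costs dissipation `≥ κν⁴λ^{−4(m+1)}/S` by `rise_dissipation`, and the summed budget caps the total by `S/2`).
[cite: Tao2016AveragedNS, §4 (4.3), Lemma 4.1 (4.5), (4.11), proof of (4.13), the viscous equation before Thm. 4.2] -/
theorem ledger_sum {ε₀ R ν T : ℝ} (hε : 0 < ε₀) (hR : 1 ≤ R) (hν : 0 < ν) (hT : 0 < T)
    {α : Fin 4 → Fin 4 → Fin 4 → ℤ × ℤ × ℤ → ℝ} (hα : InTableClass R α)
    {X₀ : Fin 4 → ℝ} {X : Fin 4 → ℤ → ℝ → ℝ}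
    (hcd : ∀ i n, ContDiffOn ℝ 1 (X i n) (Ico 0 T))
    (hinit : ∀ i n, X i n 0 = if n = 0 then X₀ i else 0)
    (hlow : ∀ i n t, n < 0 → X i n t = 0)
    (hmot : ∀ i n t, 0 ≤ t → t < T → derivWithin (X i n) (Ici 0) t =
      quadTerm ε₀ α X i n t - ν * (1 + ε₀) ^ ((2 : ℝ) * n) * X i n t)
    (hreg : ∀ T' : ℝ, 0 < T' → T' < T → ∃ M : ℝ, ∀ t : ℝ, 0 ≤ t → t ≤ T' →
      ∀ (i : Fin 4) (n : ℤ), (1 + (1 + ε₀) ^ ((10 : ℝ) * n)) * |X i n t| ≤ M)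
    (hblow : ∀ M : ℝ, ∃ t : ℝ, 0 ≤ t ∧ t < T ∧ ∃ (i : Fin 4) (n : ℤ), M < (1 + (1 + ε₀) ^ ((10 : ℝ) * n)) * |X i n t|)
    (M : ℕ) :
    2 * (3 * ((1 / (32768 * (1 + ε₀) ^ 16)) * Real.sqrt (1 / (32768 * (1 + ε₀) ^ 16))) / 4096) * ν ^ 4 *
        ∑ m ∈ Finset.range M, (((1 + ε₀) ^ 4)⁻¹) ^ (m + 1) ≤ (∑ i : Fin 4, X₀ i ^ 2) ^ 2 := by
  have hl0 : (0 : ℝ) < 1 + ε₀ := by linarith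
  have hl1 : (1 : ℝ) ≤ 1 + ε₀ := by linarith
  have hcan : IsCancellingCoeff α := hα.2.1
  have hα1 : ∀ i₁ i₂ i₃ : Fin 4, |α i₁ i₂ i₃ (0, 0, 1)| ≤ 1 := fun i₁ i₂ i₃ =>
    abs_le_one_of_inTableClass hα i₁ i₂ i₃ _ (by rw [mem_shiftSet_iff]; simp)
  set c₀ : ℝ := 1 / (32768 * (1 + ε₀) ^ 16) with hc₀
  have hc₀0 : 0 < c₀ := by rw [hc₀]; positivity
  have hE := shellEnergy_le_datum hε hν.le hcan hα1 hcd hinit hlow hmot hreg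
  set S : ℝ := ∑ i : Fin 4, X₀ i ^ 2 with hSdef
  -- firing times of the even shells `2(m+1)`
  have hfire : ∀ m : ℕ, ∃ t : ℝ, 0 ≤ t ∧ t < T ∧
      c₀ * ν ^ 2 ≤ (1 + ε₀) ^ (2 * (m + 1)) * ‖shellVec X ((2 * (m + 1) : ℕ) : ℤ) t‖ ^ 2 := fun m =>
    everyShellFires_explicit hε hR hν hT hα hcd hinit hlow hmot hreg hblow (2 * (m + 1))
  choose t ht0 htT htfire using hfire
  obtain ⟨T', hT'0, hT'T, htle⟩ := exists_window hT t htT M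
  -- the level `a_m = √c₀ · ν / λ^{m+1}` and the per-shell dissipation
  have hshell : ∀ m, m < M →
      (3 * (c₀ * Real.sqrt c₀) / 4096) * ν ^ 4 * (((1 + ε₀) ^ 4)⁻¹) ^ (m + 1) ≤
        S * (ν * (1 + ε₀) ^ (2 * (2 * (m + 1))) *
          ∫ s in Ioc 0 T', ‖shellVec X ((2 * (m + 1) : ℕ) : ℤ) s‖ ^ 2) := by
    intro m hm
    set L : ℝ := (1 + ε₀) ^ (m + 1) with hL
    have hL0 : 0 < L := by rw [hL]; positivity
    set a : ℝ := Real.sqrt c₀ * ν / L with hadef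
    have ha0 : 0 < a := by rw [hadef]; exact div_pos (mul_pos (Real.sqrt_pos.2 hc₀0) hν) hL0
    have hsq : Real.sqrt c₀ ^ 2 = c₀ := Real.sq_sqrt hc₀0.le
    have hLne : L ≠ 0 := hL0.ne'
    have hL2 : L ^ 2 = (1 + ε₀) ^ (2 * (m + 1)) := by rw [hL, ← pow_mul, mul_comm]
    have ha2 : a ^ 2 * (1 + ε₀) ^ (2 * (m + 1)) = c₀ * ν ^ 2 := by
      rw [hadef, div_pow, mul_pow, hsq, ← hL2]
      field_simp
    have hfire' : a ^ 2 ≤ ‖shellVec X ((2 * (m + 1) : ℕ) : ℤ) (t m)‖ ^ 2 := by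
      have h1 := htfire m
      have hp : 0 < (1 + ε₀) ^ (2 * (m + 1)) := by positivity
      rw [← ha2, mul_comm] at h1
      exact le_of_mul_le_mul_left h1 hp
    have hn0 : ∀ i : Fin 4, X i ((2 * (m + 1) : ℕ) : ℤ) 0 = 0 := fun i => by
      rw [hinit, if_neg (by omega)]
    have hw : (1 + ε₀) ^ ((5 : ℝ) * ((2 * (m + 1) : ℕ) : ℝ) / 2) ≤ (1 + ε₀) ^ (5 * (m + 1)) := by
      rw [show (5 : ℝ) * ((2 * (m + 1) : ℕ) : ℝ) / 2 = ((5 * (m + 1) : ℕ) : ℝ) by push_cast; ring]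
      exact (Real.rpow_natCast _ _).le
    have hrise := rise_dissipation hε hν.le hcan hα1 hcd hmot hE (2 * (m + 1)) hn0 hw ha0 (ht0 m) (htle m hm) hT'T hfire'
    -- `3a³ ≤ 4096 λ^{5(m+1)} S ∫`, and `a³ = c₀√c₀ ν³ / L³`, `λ^{5(m+1)} = L⁵`, weight `νλ^{4(m+1)} = ν L⁴`
    have hL5 : (1 + ε₀) ^ (5 * (m + 1)) = L ^ 5 := by rw [hL, ← pow_mul, mul_comm]
    have hL4 : (1 + ε₀) ^ (2 * (2 * (m + 1))) = L ^ 4 := by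
      rw [hL, ← pow_mul, show 2 * (2 * (m + 1)) = (m + 1) * 4 by ring]
    have hq : (((1 + ε₀) ^ 4)⁻¹) ^ (m + 1) = (L ^ 4)⁻¹ := by
      rw [hL, inv_pow, ← pow_mul, ← pow_mul, mul_comm 4 (m + 1)]
    have ha3 : a ^ 3 * L ^ 3 = c₀ * Real.sqrt c₀ * ν ^ 3 := by
      rw [hadef, div_pow, mul_pow]
      have : Real.sqrt c₀ ^ 3 = c₀ * Real.sqrt c₀ := by
        calc Real.sqrt c₀ ^ 3 = Real.sqrt c₀ ^ 2 * Real.sqrt c₀ := by ring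
          _ = c₀ * Real.sqrt c₀ := by rw [hsq]
      rw [this]; field_simp
    rw [hL5] at hrise
    rw [hL4, hq]
    set I : ℝ := ∫ s in Ioc 0 T', ‖shellVec X ((2 * (m + 1) : ℕ) : ℤ) s‖ ^ 2 with hI
    have hI0 : 0 ≤ I := setIntegral_nonneg measurableSet_Ioc fun s _ => sq_nonneg _
    -- target: `(3 c₀√c₀/4096) ν⁴ (L⁴)⁻¹ ≤ S (ν L⁴ I)`; multiply `hrise` by `ν L³... `
    rw [div_mul_eq_mul_div, div_mul_eq_mul_div, div_le_iff₀ (by norm_num : (0 : ℝ) < 4096)]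
    rw [show 3 * (c₀ * Real.sqrt c₀) * ν ^ 4 * (L ^ 4)⁻¹ = 3 * (a ^ 3 * L ^ 3) * ν * (L ^ 4)⁻¹ by
      rw [ha3]; ring]
    have hL4pos : 0 < L ^ 4 := by positivity
    rw [mul_inv_le_iff₀ hL4pos]
    calc 3 * (a ^ 3 * L ^ 3) * ν = (3 * a ^ 3) * (L ^ 3 * ν) := by ring
      _ ≤ (4096 * L ^ 5 * S * I) * (L ^ 3 * ν) :=
          mul_le_mul_of_nonneg_right hrise (by positivity)
      _ = S * (ν * L ^ 4 * I) * 4096 * L ^ 4 := by ring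
  -- sum and compare with the summed budget (over all shells `k < 2M + 3`)
  have hbudget := dissipation_budget_finset_sum_window hε hν hcan hα1 hcd hinit (fun i n s hn _ => hlow i n s hn)
    hmot hreg hT'0 hT'T (2 * M + 3)
  have hS2 : ∑ i : Fin 4, (1 / 2 : ℝ) * X₀ i ^ 2 = S / 2 := by
    rw [hSdef, Finset.sum_div]
    exact Finset.sum_congr rfl fun i _ => by ring
  rw [hS2] at hbudget
  -- the even shells are a sub-family of `k < 2M+3`
  set f : ℕ → ℝ := fun k => ν * (1 + ε₀) ^ (2 * k) * ∫ s in Ioc 0 T', ‖shellVec X k s‖ ^ 2 with hf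
  have hf0 : ∀ k, 0 ≤ f k := fun k => by
    rw [hf]; dsimp only
    exact mul_nonneg (by positivity) (setIntegral_nonneg measurableSet_Ioc fun s _ => sq_nonneg _)
  let emb : ℕ ↪ ℕ := ⟨fun m => 2 * (m + 1), fun a b h => by simp only at h; omega⟩
  have hsubsum : ∑ m ∈ Finset.range M, f (2 * (m + 1)) ≤ ∑ k ∈ Finset.range (2 * M + 3), f k := by
    have h1 : ∑ m ∈ Finset.range M, f (2 * (m + 1)) = ∑ k ∈ (Finset.range M).map emb, f k := by
      rw [Finset.sum_map]; rfl
    rw [h1]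
    refine Finset.sum_le_sum_of_subset_of_nonneg ?_ fun k _ _ => hf0 k
    intro k hk
    rw [Finset.mem_map] at hk
    obtain ⟨m, hm, rfl⟩ := hk
    rw [Finset.mem_range] at hm ⊢
    show 2 * (m + 1) < 2 * M + 3
    omega
  have hsumle : ∑ m ∈ Finset.range M,
      (3 * (c₀ * Real.sqrt c₀) / 4096) * ν ^ 4 * (((1 + ε₀) ^ 4)⁻¹) ^ (m + 1) ≤ S * (S / 2) := by
    calc ∑ m ∈ Finset.range M, (3 * (c₀ * Real.sqrt c₀) / 4096) * ν ^ 4 * (((1 + ε₀) ^ 4)⁻¹) ^ (m + 1)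
        ≤ ∑ m ∈ Finset.range M, S * f (2 * (m + 1)) :=
          Finset.sum_le_sum fun m hm => hshell m (Finset.mem_range.1 hm)
      _ = S * ∑ m ∈ Finset.range M, f (2 * (m + 1)) := by rw [Finset.mul_sum]
      _ ≤ S * ∑ k ∈ Finset.range (2 * M + 3), f k :=
          mul_le_mul_of_nonneg_left hsubsum (Finset.sum_nonneg fun i _ => sq_nonneg _)
      _ ≤ S * (S / 2) := mul_le_mul_of_nonneg_left hbudget (Finset.sum_nonneg fun i _ => sq_nonneg _)
  rw [← Finset.mul_sum] at hsumle
  linarith [hsumle]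

/-! ## In the skeleton's vocabulary -/

/-- **REYNOLDS-THRESHOLD DIVERGENCE.**  For every `ε₀ > 0`, every table of `InTableClass R` (`R ≥ 1`), every `ν > 0` and every one-shell datum
`X₀`: if a regular trajectory of the exact `ν`-viscous NS-scaled lattice from `X₀` blows up at `t⋆` (`ViscousUpTo ∧ BlowsUpAt`), then
`ν⁴ ≤ 2³³ (1+ε₀)²⁴ ((1+ε₀)⁴ − 1) (Σ_i X₀ᵢ²)²`.  As `ε₀ → 0` the right-hand factor `(1+ε₀)⁴ − 1 ≍ 4ε₀` vanishes: the Reynolds number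
`Σ_i X₀ᵢ²/ν²` of a blow-up is at least `≍ ε₀^{−1/2}`.
[cite: Tao2016AveragedNS, §4 (4.3), Lemma 4.1 (4.5), (4.11), proof of (4.13), the viscous equation before Thm. 4.2; cell vocabulary] -/
theorem reynolds_threshold_of_blowsUpAt {R ε₀ ν : ℝ} (hR : 1 ≤ R) (hε₀ : 0 < ε₀) (hν : 0 < ν)
    {α : Fin 4 → Fin 4 → Fin 4 → ℤ × ℤ × ℤ → ℝ} {X₀ : Fin 4 → ℝ} (hα : InTableClass R α)
    {X : Fin 4 → ℤ → ℝ → ℝ} {tStar : ℝ} (hV : ViscousUpTo ε₀ ν α X₀ X tStar) (hB : BlowsUpAt ε₀ X tStar) :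
    ν ^ 4 ≤ 2 ^ 33 * (1 + ε₀) ^ 24 * ((1 + ε₀) ^ 4 - 1) * (∑ i : Fin 4, X₀ i ^ 2) ^ 2 := by
  have hl0 : (0 : ℝ) < 1 + ε₀ := by linarith
  have hl1 : (1 : ℝ) < 1 + ε₀ := by linarith
  have hT : 0 < tStar := hV.pos
  obtain ⟨Z, hZX, hcdZ, hinitZ, hlowZ, hmotZ, hregZ⟩ := zeroNeg_clauses hV
  have hblowZ : ∀ M : ℝ, ∃ t : ℝ, 0 ≤ t ∧ t < tStar ∧
      ∃ (i : Fin 4) (n : ℤ), M < (1 + (1 + ε₀) ^ ((10 : ℝ) * n)) * |Z i n t| := by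
    intro M
    obtain ⟨t, ht0, htT, i, n, hlt⟩ := hB M
    exact ⟨t, ht0, htT, i, n, by rw [hZX i n t ht0 htT]; exact hlt⟩
  have hledger := fun M => ledger_sum hε₀ hR hν hT hα hcdZ hinitZ hlowZ hmotZ hregZ hblowZ M
  set S : ℝ := ∑ i : Fin 4, X₀ i ^ 2 with hSdef
  set c₀ : ℝ := 1 / (32768 * (1 + ε₀) ^ 16) with hc₀
  have hc₀0 : 0 < c₀ := by rw [hc₀]; positivity
  set K : ℝ := 2 * (3 * (c₀ * Real.sqrt c₀) / 4096) * ν ^ 4 with hK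
  set q : ℝ := ((1 + ε₀) ^ 4)⁻¹ with hq
  have hl4 : 1 < (1 + ε₀) ^ 4 := one_lt_pow₀ hl1 (by norm_num)
  have hq0 : 0 ≤ q := by rw [hq]; positivity
  have hq1 : q < 1 := by rw [hq]; exact inv_lt_one_of_one_lt₀ hl4
  -- partial sums `K Σ_{m<M} q^{m+1} ≤ S²` for all `M`, hence `K · q/(1-q) ≤ S²`
  have hpart : ∀ M : ℕ, ∑ m ∈ Finset.range M, K * q ^ (m + 1) ≤ S ^ 2 := by
    intro M
    have h := hledger M
    rw [← Finset.mul_sum]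
    exact h
  have htsum : ∑' m : ℕ, K * q ^ (m + 1) ≤ S ^ 2 :=
    Real.tsum_le_of_sum_range_le (fun m => by positivity) hpart
  have hgeom : ∑' m : ℕ, K * q ^ (m + 1) = K * (q / (1 - q)) := by
    rw [tsum_mul_left]
    congr 1
    rw [show (fun m : ℕ => q ^ (m + 1)) = fun m : ℕ => q * q ^ m by funext m; rw [pow_succ]; ring,
      tsum_mul_left, tsum_geometric_of_lt_one hq0 hq1, div_eq_mul_inv]
  rw [hgeom] at htsum
  have hqq : q / (1 - q) = 1 / ((1 + ε₀) ^ 4 - 1) := by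
    rw [hq]
    have hne : (1 + ε₀) ^ 4 - 1 ≠ 0 := by linarith
    have hne' : (1 + ε₀) ^ 4 ≠ 0 := by positivity
    field_simp
  rw [hqq] at htsum
  have hden : 0 < (1 + ε₀) ^ 4 - 1 := by linarith
  have hKle : K ≤ ((1 + ε₀) ^ 4 - 1) * S ^ 2 := by
    have h1 : K / ((1 + ε₀) ^ 4 - 1) ≤ S ^ 2 := by rw [← mul_one_div]; exact htsum
    rw [div_le_iff₀ hden] at h1
    linarith [h1]
  -- `K ≥ 2^{-33} λ^{-24} ν⁴`: `√c₀ ≥ 1/(256 λ^8)` since `256² = 65536 ≥ 32768`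
  have hsqrt : 1 / (256 * (1 + ε₀) ^ 8) ≤ Real.sqrt c₀ := by
    rw [hc₀, Real.le_sqrt (by positivity) (by positivity)]
    have hEq : (1 / (256 * (1 + ε₀) ^ 8)) ^ 2 = 1 / (65536 * (1 + ε₀) ^ 16) := by
      rw [div_pow, one_pow, mul_pow, ← pow_mul]; norm_num
    rw [hEq]
    exact one_div_le_one_div_of_le (by positivity) (by nlinarith [pow_pos hl0 16])
  have hKge : ν ^ 4 / (2 ^ 33 * (1 + ε₀) ^ 24) ≤ K := by
    have hcs : 1 / (32768 * (1 + ε₀) ^ 16) * (1 / (256 * (1 + ε₀) ^ 8)) ≤ c₀ * Real.sqrt c₀ := by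
      rw [← hc₀]; exact mul_le_mul_of_nonneg_left hsqrt hc₀0.le
    have hEq : 2 * (3 * (1 / (32768 * (1 + ε₀) ^ 16) * (1 / (256 * (1 + ε₀) ^ 8))) / 4096) * ν ^ 4
        = 3 * ν ^ 4 / (2 ^ 34 * (1 + ε₀) ^ 24) := by
      field_simp
      ring
    calc ν ^ 4 / (2 ^ 33 * (1 + ε₀) ^ 24)
        ≤ 3 * ν ^ 4 / (2 ^ 34 * (1 + ε₀) ^ 24) := by
          rw [div_le_div_iff₀ (by positivity) (by positivity)]
          nlinarith [mul_pos (pow_pos hν 4) (pow_pos hl0 24)]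
      _ = 2 * (3 * (1 / (32768 * (1 + ε₀) ^ 16) * (1 / (256 * (1 + ε₀) ^ 8))) / 4096) * ν ^ 4 := hEq.symm
      _ ≤ 2 * (3 * (c₀ * Real.sqrt c₀) / 4096) * ν ^ 4 := by
          gcongr
  have hfin : ν ^ 4 / (2 ^ 33 * (1 + ε₀) ^ 24) ≤ ((1 + ε₀) ^ 4 - 1) * S ^ 2 := hKge.trans hKle
  rw [div_le_iff₀ (by positivity)] at hfin
  linarith

/-- **The same for `ε₀ ≤ 1`, with an absolute constant**: blow-up ⟹ `ν⁴ ≤ 2⁶¹ · ε₀ · (Σ_i X₀ᵢ²)²` (`(1+ε₀)²⁴ ≤ 2²⁴`, `(1+ε₀)⁴ − 1 ≤ 15ε₀`).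
The Reynolds number of a sub-threshold viscous blow-up satisfies `(Σ_i X₀ᵢ²/ν²)² ≥ 2^{−61}/ε₀`.
[cite: Tao2016AveragedNS, §4 (4.3), Lemma 4.1 (4.5), (4.11), proof of (4.13), the viscous equation before Thm. 4.2; cell vocabulary] -/
theorem reynolds_threshold_of_blowsUpAt_le_one {R ε₀ ν : ℝ} (hR : 1 ≤ R) (hε₀ : 0 < ε₀) (hε₁ : ε₀ ≤ 1) (hν : 0 < ν)
    {α : Fin 4 → Fin 4 → Fin 4 → ℤ × ℤ × ℤ → ℝ} {X₀ : Fin 4 → ℝ} (hα : InTableClass R α)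
    {X : Fin 4 → ℤ → ℝ → ℝ} {tStar : ℝ} (hV : ViscousUpTo ε₀ ν α X₀ X tStar) (hB : BlowsUpAt ε₀ X tStar) :
    ν ^ 4 ≤ 2 ^ 61 * ε₀ * (∑ i : Fin 4, X₀ i ^ 2) ^ 2 := by
  have h := reynolds_threshold_of_blowsUpAt hR hε₀ hν hα hV hB
  have hl0 : (0 : ℝ) < 1 + ε₀ := by linarith
  have h24 : (1 + ε₀) ^ 24 ≤ 2 ^ 24 := pow_le_pow_left₀ hl0.le (by linarith) 24
  have hε2 : ε₀ ^ 2 ≤ ε₀ := by nlinarith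
  have hε3 : ε₀ ^ 3 ≤ ε₀ := by nlinarith
  have hε4 : ε₀ ^ 4 ≤ ε₀ := by nlinarith
  have hexp : (1 + ε₀) ^ 4 - 1 = 4 * ε₀ + 6 * ε₀ ^ 2 + 4 * ε₀ ^ 3 + ε₀ ^ 4 := by ring
  have h4 : (1 + ε₀) ^ 4 - 1 ≤ 15 * ε₀ := by rw [hexp]; linarith
  have h4' : 0 ≤ (1 + ε₀) ^ 4 - 1 := by rw [hexp]; positivity
  have hS : 0 ≤ (∑ i : Fin 4, X₀ i ^ 2) ^ 2 := sq_nonneg _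
  have hA : 2 ^ 33 * (1 + ε₀) ^ 24 * ((1 + ε₀) ^ 4 - 1) ≤ 2 ^ 33 * 2 ^ 24 * (15 * ε₀) := by
    have := mul_le_mul h24 h4 h4' (by positivity : (0 : ℝ) ≤ 2 ^ 24)
    linarith [this]
  calc ν ^ 4 ≤ 2 ^ 33 * (1 + ε₀) ^ 24 * ((1 + ε₀) ^ 4 - 1) * (∑ i : Fin 4, X₀ i ^ 2) ^ 2 := h
    _ ≤ 2 ^ 33 * 2 ^ 24 * (15 * ε₀) * (∑ i : Fin 4, X₀ i ^ 2) ^ 2 := mul_le_mul_of_nonneg_right hA hS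
    _ ≤ 2 ^ 61 * ε₀ * (∑ i : Fin 4, X₀ i ^ 2) ^ 2 := by nlinarith [mul_nonneg hε₀.le hS]

/-- **NO BLOW-UP AT SMALL REYNOLDS NUMBER relative to the scale ratio**: for `0 < ε₀ ≤ 1`, every table of `InTableClass R`, every `ν > 0` and
every datum with `2⁶¹ ε₀ (Σ_i X₀ᵢ²)² < ν⁴`, NO regular trajectory of the exact `ν`-viscous lattice from `X₀` blows up.  The excluded class
`Σ_i X₀ᵢ²/ν² < 2^{−30.5} ε₀^{−1/2}` exhausts every bounded set of data as `ε₀ → 0`.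
[cite: Tao2016AveragedNS, §4 (4.3), Lemma 4.1 (4.5), (4.11), the viscous equation before Thm. 4.2; cell vocabulary] -/
theorem not_blowsUpAt_of_small_reynolds {R ε₀ ν : ℝ} (hR : 1 ≤ R) (hε₀ : 0 < ε₀) (hε₁ : ε₀ ≤ 1) (hν : 0 < ν)
    {α : Fin 4 → Fin 4 → Fin 4 → ℤ × ℤ × ℤ → ℝ} {X₀ : Fin 4 → ℝ} (hα : InTableClass R α)
    (hsmall : 2 ^ 61 * ε₀ * (∑ i : Fin 4, X₀ i ^ 2) ^ 2 < ν ^ 4)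
    {X : Fin 4 → ℤ → ℝ → ℝ} {tStar : ℝ} (hV : ViscousUpTo ε₀ ν α X₀ X tStar) : ¬ BlowsUpAt ε₀ X tStar :=
  fun hB => absurd (reynolds_threshold_of_blowsUpAt_le_one hR hε₀ hε₁ hν hα hV hB) (not_le.2 hsmall)

/-- **Both open stubs of ⟨20420⟩ on the small-Reynolds class** (vacuously; binder order of the registered skeleton after `R`, every
`0 < ε₀ ≤ 1`, every table, every `ν`): for data with `2⁶¹ ε₀ (Σ_i X₀ᵢ²)² < ν⁴` the conclusions of (ω3) `stub_typeOne` AND (ω4)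
`stub_eternalLimitViscBdd` hold — there is no blow-up to be type I or to extract from.  What is left of (ω3)/(ω4) is the class
`(Σ_i X₀ᵢ²)² ≥ 2^{−61} ν⁴/ε₀`.
[cite: Tao2016AveragedNS, §4 Thm. 4.2 (statement shape), Lemma 4.1 (4.5), §6.4; cell vocabulary] -/
theorem stubs_of_small_reynolds :
    ∀ R : ℝ, 1 ≤ R → ∀ ε₀ : ℝ, 0 < ε₀ → ε₀ ≤ 1 →
      ∀ (α : Fin 4 → Fin 4 → Fin 4 → ℤ × ℤ × ℤ → ℝ) (X₀ : Fin 4 → ℝ), InTableClass R α →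
        ∀ ν : ℝ, 0 < ν → 2 ^ 61 * ε₀ * (∑ i : Fin 4, X₀ i ^ 2) ^ 2 < ν ^ 4 →
          ∀ (X : Fin 4 → ℤ → ℝ → ℝ) (tStar : ℝ), ViscousUpTo ε₀ ν α X₀ X tStar → BlowsUpAt ε₀ X tStar →
            TypeOne ε₀ X tStar ∧
              ∃ (νh : ℝ) (W : ℤ → ℝ → Em 4), IsEternalVisc ε₀ νh α W ∧ UniformBound W ∧
                EternalSurvivingFwd 1 ε₀ W := by
  intro R hR ε₀ hε₀ hε₁ α X₀ hα ν hν hsmall X tStar hV hB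
  exact absurd hB (not_blowsUpAt_of_small_reynolds hR hε₀ hε₁ hν hα hsmall hV)

/-- **FIXED-REYNOLDS REGULARITY as the scale ratio tends to one.**  For every one-shell datum `X₀` and every `ν > 0` there is `ε₁ > 0`
(`ε₁ = min 1 (ν⁴/(2⁶² (Σ_i X₀ᵢ²)² + 1))` will do) such that for ALL `ε₀ ∈ (0, ε₁]`, ALL spreads `R ≥ 1` and ALL tables of `InTableClass R`,
no regular trajectory of the exact `ν`-viscous NS-scaled lattice from `X₀` blows up.  (Quantifier order complementary to the stubs':
there `εs` is chosen before the datum and the viscosity.)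
[cite: Tao2016AveragedNS, §4 (4.3), Lemma 4.1 (4.5), (4.11), the viscous equation before Thm. 4.2; cell vocabulary] -/
theorem eventually_regular_of_fixed_datum (X₀ : Fin 4 → ℝ) {ν : ℝ} (hν : 0 < ν) :
    ∃ ε₁ : ℝ, 0 < ε₁ ∧ ∀ ε₀ : ℝ, 0 < ε₀ → ε₀ ≤ ε₁ → ∀ R : ℝ, 1 ≤ R →
      ∀ α : Fin 4 → Fin 4 → Fin 4 → ℤ × ℤ × ℤ → ℝ, InTableClass R α →
        ∀ (X : Fin 4 → ℤ → ℝ → ℝ) (tStar : ℝ), ViscousUpTo ε₀ ν α X₀ X tStar → ¬ BlowsUpAt ε₀ X tStar := by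
  set S : ℝ := ∑ i : Fin 4, X₀ i ^ 2 with hS
  set ε₁ : ℝ := min 1 (ν ^ 4 / (2 ^ 62 * S ^ 2 + 1)) with hε₁
  have hD : 0 < 2 ^ 62 * S ^ 2 + 1 := by positivity
  have hε₁0 : 0 < ε₁ := lt_min one_pos (div_pos (by positivity) hD)
  refine ⟨ε₁, hε₁0, fun ε₀ hε₀ hle R hR α hα X tStar hV => ?_⟩
  have hle1 : ε₀ ≤ 1 := hle.trans (min_le_left _ _)
  have hle2 : ε₀ ≤ ν ^ 4 / (2 ^ 62 * S ^ 2 + 1) := hle.trans (min_le_right _ _)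
  refine not_blowsUpAt_of_small_reynolds hR hε₀ hle1 hν hα ?_ hV
  have h1 : ε₀ * (2 ^ 62 * S ^ 2 + 1) ≤ ν ^ 4 := (le_div_iff₀ hD).1 hle2
  nlinarith [mul_nonneg hε₀.le (sq_nonneg S), hε₀, h1]

end Summit.NavierStokesRegularity.NavierStokesRegularity.Theorems.EternalRigidityViscBddOne.ReynoldsThreshold

end
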